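import Summits.Ventures.LatticeQCDFlow.Exactness.FlowSamplerPositive
import HarnessLib

/-!
# The exact flow sampler on SQUARE-INTEGRABLE observables: well-defined, linear and exact on `L¹(e^{−S})`, Fubini-ready on `L²(e^{−S})`

HONEST FRAMING: exact (Metropolis-corrected) sampling algorithms for lattice gauge theory;
figures of merit are autocorrelation/cost numbers at stated couplings and volumes; no
continuum-physics claim.  (SCALAR calibration rung S0-A: not a gauge result.)

Venture `LatticeQCDFlow` (cell pub-lqcd), topic `Exactness`; FANOUT row 2 (`s0-phi4`, FLOW arm:
independence Metropolis `K = imhOp μ w q̃`, target weight `w = e^{−S}`, model density `q̃ > 0` with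
`∫ q̃ = 1`).  NEW WORK of the cell over Mathlib and the tree's flow-sampler toolbox
(`FlowSamplerOperator`, `Phi4IndependenceSamplerExact` / `…Reversible`, `FlowSamplerPositive`).
Nothing is cited as a fact.  Printed counterparts NAMED ONLY: Tierney 1994 (Metropolis–Hastings
kernels are self-adjoint contractions of `L²(π)`), Liu 1996 / Liu, *Monte Carlo Strategies* §13.4
Thm 13.4.1 (spectrum of the Metropolized independence sampler, finite state space).

## Why this file (row 2's leftover (γ⁸) = (α⁶) = gen-12 (α))

Every flow-arm theorem of the tree (exactness, detailed balance, positivity, all `τ_int` floors,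
monotone/convex autocovariances, thinning) is typed for BOUNDED measurable observables, because the
toolbox lemmas carry a hypothesis `|g| ≤ B`.  The calibration's headline observables — the
magnetisation `M = Σ_x φ_x`, `M²`, the action — are unbounded.  Here the toolbox is re-proved for the
class of MEASURABLE SQUARE-INTEGRABLE observables `∫ g² w < ∞` (and, where that is all that is used,
for `∫ |g| w < ∞`), with NO hypothesis on the model density beyond positivity, measurability and
`∫ q̃ = 1`: the accepted-jump density from `t` is dominated by `(q̃(t)/w(t))·w`, so `K g` is defined on
`L¹(w)`; the symmetric kernel `s(t,t') = min(w(t) q̃(t'), w(t') q̃(t))` is dominated on the product by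
`w(t) g(t)² q̃(t') + q̃(t) w(t') g(t')²`-type sums, so every Fubini step goes through on `L²(w)`.

## What is proved (general `(X, μ)` s-finite; `w > 0` integrable, `q > 0` measurable integrable,
`∫ q = 1` where stated)

* the class: `integrable_abs_mul_weight_of_sq`, `integrable_mul_mul_weight_of_sq` ((int):
  `f h w ∈ L¹` for square-integrable `f, h`), `sq_integrable_add_mul` ((comb)), `sq_integrable_of_bdd`;
* the operator on `L¹(w)`: `imhAcceptQ_mul_le` (`α(t,t') q(t') ≤ q(t) w(t')/w(t)`),
  `integrable_imh_jump`, `integrable_imhOp_integrand_of_mul_weight`, **`imhOp_mul_mul_weight_eq`**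
  (`(K g)(t)·c·w(t) = ∫ s(t,t') g(t') c dt' + g(t) c w(t) r(t)`, `r` the rejection probability),
  **`imhOp_add_mul_of_mul_weight`** ((lin));
* product integrability: `integrable_imhFlow_mul_snd/fst` (`L¹(w)`),
  **`integrable_imhFlow_mul_mul_of_sq`** (`s(t,t') f(t') h(t) ∈ L¹(μ ⊗ μ)` for square-integrable `f, h`);
* **`integral_imhOp_mul_weight`** — EXACTNESS ON `L¹(w)`: `(K g) w ∈ L¹` and `∫ (K g) w = ∫ g w`.

Detailed balance, contraction, stability of the class, positivity and the `τ_int` consequences are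
the companion files `FlowSamplerSquareIntegrableContraction.lean` / `…Positive.lean`.
NOT CLAIMED: anything for non-square-integrable observables; any rate; any number for a trained
network.
-/

namespace Summit.Ventures.LatticeQCDFlow.Exactness

open Real MeasureTheory Filter Finset Set

section General

variable {X : Type*} [MeasurableSpace X] {μ : Measure X} {w q : X → ℝ}

/-! ## §1 The square-integrable class -/

/-- A square-integrable observable is absolutely integrable against the (finite) weight:
`∫ f² w < ∞`, `∫ w < ∞ ⇒ |f| w ∈ L¹`. -/
theorem integrable_abs_mul_weight_of_sq (hw0 : ∀ t, 0 ≤ w t) (hwm : Measurable w)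
    (hwi : Integrable w μ) {f : X → ℝ} (hfm : Measurable f)
    (hf2 : Integrable (fun t => f t ^ 2 * w t) μ) :
    Integrable (fun t => |f t| * w t) μ := by
  refine Integrable.mono' (hf2.add hwi)
    ((continuous_abs.measurable.comp hfm).mul hwm).aestronglyMeasurable
    (Eventually.of_forall fun t => ?_)
  show ‖|f t| * w t‖ ≤ f t ^ 2 * w t + w t
  rw [Real.norm_eq_abs, abs_mul, abs_abs, abs_of_nonneg (hw0 t)]
  have h1 : |f t| ≤ f t ^ 2 + 1 := by
    nlinarith [sq_nonneg (|f t| - 1 / 2), sq_abs (f t), abs_nonneg (f t)]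
  calc |f t| * w t ≤ (f t ^ 2 + 1) * w t := mul_le_mul_of_nonneg_right h1 (hw0 t)
    _ = f t ^ 2 * w t + w t := by ring

/-- `f w ∈ L¹` for square-integrable `f`. -/
theorem integrable_mul_weight_of_sq (hw0 : ∀ t, 0 ≤ w t) (hwm : Measurable w)
    (hwi : Integrable w μ) {f : X → ℝ} (hfm : Measurable f)
    (hf2 : Integrable (fun t => f t ^ 2 * w t) μ) :
    Integrable (fun t => f t * w t) μ := by
  refine (integrable_abs_mul_weight_of_sq hw0 hwm hwi hfm hf2).mono' (hfm.mul hwm).aestronglyMeasurable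
    (Eventually.of_forall fun t => ?_)
  show ‖f t * w t‖ ≤ |f t| * w t
  rw [Real.norm_eq_abs, abs_mul, abs_of_nonneg (hw0 t)]

/-- `|a| |b| ≤ a² + b²` (as a product of absolute values; used for every domination below). -/
theorem abs_mul_abs_le_sq_add_sq (a b : ℝ) : |a| * |b| ≤ a ^ 2 + b ^ 2 := by
  nlinarith [sq_nonneg (|a| - |b|), sq_abs a, sq_abs b, abs_nonneg a, abs_nonneg b]

/-- **(int) on the square-integrable class**: `f h w ∈ L¹` (`|f h| ≤ f² + h²`). -/
theorem integrable_mul_mul_weight_of_sq (hw0 : ∀ t, 0 ≤ w t) (hwm : Measurable w)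
    {f h : X → ℝ} (hfm : Measurable f) (hhm : Measurable h)
    (hf2 : Integrable (fun t => f t ^ 2 * w t) μ) (hh2 : Integrable (fun t => h t ^ 2 * w t) μ) :
    Integrable (fun t => f t * h t * w t) μ := by
  refine Integrable.mono' (hf2.add hh2) ((hfm.mul hhm).mul hwm).aestronglyMeasurable
    (Eventually.of_forall fun t => ?_)
  show ‖f t * h t * w t‖ ≤ f t ^ 2 * w t + h t ^ 2 * w t
  rw [Real.norm_eq_abs, abs_mul, abs_of_nonneg (hw0 t), abs_mul]
  calc |f t| * |h t| * w t ≤ (f t ^ 2 + h t ^ 2) * w t :=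
        mul_le_mul_of_nonneg_right (abs_mul_abs_le_sq_add_sq _ _) (hw0 t)
    _ = f t ^ 2 * w t + h t ^ 2 * w t := by ring

/-- **(comb)**: the class is closed under `f + c h` (`(f + c h)² ≤ 2 f² + 2 c² h²`). -/
theorem sq_integrable_add_mul (hw0 : ∀ t, 0 ≤ w t) (hwm : Measurable w)
    {f h : X → ℝ} (hfm : Measurable f) (hhm : Measurable h)
    (hf2 : Integrable (fun t => f t ^ 2 * w t) μ) (hh2 : Integrable (fun t => h t ^ 2 * w t) μ)
    (c : ℝ) :
    Measurable (fun t => f t + c * h t) ∧ Integrable (fun t => (f t + c * h t) ^ 2 * w t) μ := by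
  refine ⟨hfm.add (measurable_const.mul hhm), ?_⟩
  refine Integrable.mono' ((hf2.const_mul 2).add (hh2.const_mul (2 * c ^ 2)))
    (((hfm.add (measurable_const.mul hhm)).pow_const 2).mul hwm).aestronglyMeasurable
    (Eventually.of_forall fun t => ?_)
  show ‖(f t + c * h t) ^ 2 * w t‖ ≤ 2 * (f t ^ 2 * w t) + 2 * c ^ 2 * (h t ^ 2 * w t)
  rw [Real.norm_eq_abs, abs_of_nonneg (mul_nonneg (sq_nonneg _) (hw0 t))]
  have hsq : (f t + c * h t) ^ 2 ≤ 2 * f t ^ 2 + 2 * c ^ 2 * h t ^ 2 := by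
    nlinarith [sq_nonneg (f t - c * h t)]
  calc (f t + c * h t) ^ 2 * w t ≤ (2 * f t ^ 2 + 2 * c ^ 2 * h t ^ 2) * w t :=
        mul_le_mul_of_nonneg_right hsq (hw0 t)
    _ = 2 * (f t ^ 2 * w t) + 2 * c ^ 2 * (h t ^ 2 * w t) := by ring

/-- Bounded measurable observables are in the class (`g² w ≤ B² w`). -/
theorem sq_integrable_of_bdd (hw0 : ∀ t, 0 ≤ w t) (hwm : Measurable w) (hwi : Integrable w μ)
    {g : X → ℝ} (hgm : Measurable g) {B : ℝ} (hgb : ∀ t, |g t| ≤ B) :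
    Integrable (fun t => g t ^ 2 * w t) μ := by
  refine Integrable.mono' (hwi.const_mul (B ^ 2)) ((hgm.pow_const 2).mul hwm).aestronglyMeasurable
    (Eventually.of_forall fun t => ?_)
  show ‖g t ^ 2 * w t‖ ≤ B ^ 2 * w t
  rw [Real.norm_eq_abs, abs_of_nonneg (mul_nonneg (sq_nonneg _) (hw0 t))]
  refine mul_le_mul_of_nonneg_right ?_ (hw0 t)
  rw [← sq_abs]
  exact pow_le_pow_left₀ (abs_nonneg _) (hgb t) 2

/-! ## §2 The operator on `L¹(w)`: the jump part is dominated by `(q(t)/w(t))·|g| w` -/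

omit [MeasurableSpace X] in
/-- **The accepted-jump density is dominated**: `α(t,t') q(t') ≤ (q(t)/w(t)) w(t')`
(`α q' w = s ≤ w' q`). -/
theorem imhAcceptQ_mul_le (hw0 : ∀ t, 0 < w t) (hq0 : ∀ t, 0 < q t) (t t' : X) :
    imhAcceptQ w q t t' * q t' ≤ q t / w t * w t' := by
  have h : imhAcceptQ w q t t' * q t' * w t = imhFlow w q t t' := by
    unfold imhAcceptQ; exact imh_accept_mul_weight w q (hw0 t) (hq0 t')
  have h2 : imhFlow w q t t' ≤ w t' * q t := by
    rw [imhFlow_symm]; exact (imhFlow_nonneg_le hw0 hq0 t' t).2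
  rw [← h] at h2
  have h3 : imhAcceptQ w q t t' * q t' ≤ w t' * q t / w t := (le_div_iff₀ (hw0 t)).2 h2
  calc imhAcceptQ w q t t' * q t' ≤ w t' * q t / w t := h3
    _ = q t / w t * w t' := by ring

/-- The rejection integrand `(1 − α(t,·)) q` is integrable (dominated by `q`). -/
theorem integrable_one_sub_imhAcceptQ_mul (hw0 : ∀ t, 0 < w t) (hwm : Measurable w)
    (hq0 : ∀ t, 0 < q t) (hqm : Measurable q) (hqi : Integrable q μ) (t : X) :
    Integrable (fun t' => (1 - imhAcceptQ w q t t') * q t') μ := by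
  have ham : Measurable fun t' => imhAcceptQ w q t t' :=
    (measurable_imhAcceptQ hwm hqm).comp (measurable_const.prodMk measurable_id)
  refine Integrable.mono' hqi ((measurable_const.sub ham).mul hqm).aestronglyMeasurable
    (Eventually.of_forall fun t' => ?_)
  rw [Real.norm_eq_abs, abs_mul, abs_of_nonneg (sub_nonneg.2 (imhAcceptQ_le_one w q t t')),
    abs_of_pos (hq0 t')]
  have h0 := imhAcceptQ_nonneg hw0 hq0 t t'
  have h1 := hq0 t'
  nlinarith

/-- The accepted-jump integrand `α(t,·) q` is integrable (dominated by `q`). -/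
theorem integrable_imhAcceptQ_mul (hw0 : ∀ t, 0 < w t) (hwm : Measurable w)
    (hq0 : ∀ t, 0 < q t) (hqm : Measurable q) (hqi : Integrable q μ) (t : X) :
    Integrable (fun t' => imhAcceptQ w q t t' * q t') μ := by
  have ham : Measurable fun t' => imhAcceptQ w q t t' :=
    (measurable_imhAcceptQ hwm hqm).comp (measurable_const.prodMk measurable_id)
  refine Integrable.mono' hqi (ham.mul hqm).aestronglyMeasurable (Eventually.of_forall fun t' => ?_)
  rw [Real.norm_eq_abs, abs_mul, abs_of_nonneg (imhAcceptQ_nonneg hw0 hq0 t t'), abs_of_pos (hq0 t')]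
  exact mul_le_of_le_one_left (hq0 t').le (imhAcceptQ_le_one w q t t')

/-- **The jump part of `K g` is defined on `L¹(w)`**: `t' ↦ α(t,t') q(t') g(t')` is integrable for
every measurable `g` with `g w ∈ L¹`, from every current state `t`. -/
theorem integrable_imh_jump (hw0 : ∀ t, 0 < w t) (hwm : Measurable w) (hq0 : ∀ t, 0 < q t)
    (hqm : Measurable q) {g : X → ℝ} (hgm : Measurable g)
    (hgw : Integrable (fun t => g t * w t) μ) (t : X) :
    Integrable (fun t' => imhAcceptQ w q t t' * q t' * g t') μ := by
  have ham : Measurable fun t' => imhAcceptQ w q t t' :=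
    (measurable_imhAcceptQ hwm hqm).comp (measurable_const.prodMk measurable_id)
  refine Integrable.mono' (hgw.abs.const_mul (q t / w t)) ((ham.mul hqm).mul hgm).aestronglyMeasurable
    (Eventually.of_forall fun t' => ?_)
  show ‖imhAcceptQ w q t t' * q t' * g t'‖ ≤ q t / w t * |g t' * w t'|
  rw [Real.norm_eq_abs, abs_mul,
    abs_of_nonneg (mul_nonneg (imhAcceptQ_nonneg hw0 hq0 t t') (hq0 t').le)]
  calc imhAcceptQ w q t t' * q t' * |g t'| ≤ q t / w t * w t' * |g t'| :=
        mul_le_mul_of_nonneg_right (imhAcceptQ_mul_le hw0 hq0 t t') (abs_nonneg _)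
    _ = q t / w t * |g t' * w t'| := by
        rw [abs_mul, abs_of_pos (hw0 t')]; ring

/-- The full one-step integrand of `K g` at `t` is integrable for `g ∈ L¹(w)`. -/
theorem integrable_imhOp_integrand_of_mul_weight (hw0 : ∀ t, 0 < w t) (hwm : Measurable w)
    (hq0 : ∀ t, 0 < q t) (hqm : Measurable q) (hqi : Integrable q μ) {g : X → ℝ}
    (hgm : Measurable g) (hgw : Integrable (fun t => g t * w t) μ) (t : X) :
    Integrable (fun t' => (imhAcceptQ w q t t' * g t' + (1 - imhAcceptQ w q t t') * g t) * q t') μ := by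
  have h1 := integrable_imh_jump hw0 hwm hq0 hqm hgm hgw t
  have h2 := integrable_one_sub_imhAcceptQ_mul (μ := μ) hw0 hwm hq0 hqm hqi t
  refine (h1.add (h2.const_mul (g t))).congr (Eventually.of_forall fun t' => ?_)
  show imhAcceptQ w q t t' * q t' * g t' + g t * ((1 - imhAcceptQ w q t t') * q t') = _
  ring

/-- **Pointwise split of `(K g)·c·w`** into the symmetric off-diagonal part and the rejection part,
for `g ∈ L¹(w)` and any real `c` (the value of a test observable at `t`):
`(K g)(t) c w(t) = ∫ s(t,t') g(t') c dμ(t') + g(t) c w(t) r(t)`, `r(t) = ∫ (1 − α(t,t')) q(t') dμ(t')`. -/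
theorem imhOp_mul_mul_weight_eq (hw0 : ∀ t, 0 < w t) (hwm : Measurable w) (hq0 : ∀ t, 0 < q t)
    (hqm : Measurable q) (hqi : Integrable q μ) {g : X → ℝ} (hgm : Measurable g)
    (hgw : Integrable (fun t => g t * w t) μ) (t : X) (c : ℝ) :
    imhOp μ w q g t * c * w t
      = (∫ t', imhFlow w q t t' * g t' * c ∂μ)
        + g t * c * w t * ∫ t', (1 - imhAcceptQ w q t t') * q t' ∂μ := by
  unfold imhOp
  have h1 := integrable_imh_jump hw0 hwm hq0 hqm hgm hgw t
  have h2 := integrable_one_sub_imhAcceptQ_mul (μ := μ) hw0 hwm hq0 hqm hqi t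
  have e : ∀ t', (imhAcceptQ w q t t' * g t' + (1 - imhAcceptQ w q t t') * g t) * q t'
      = imhAcceptQ w q t t' * q t' * g t' + g t * ((1 - imhAcceptQ w q t t') * q t') := fun t' => by
    ring
  simp_rw [e]
  rw [integral_add h1 (h2.const_mul (g t)), integral_const_mul]
  have e2 : (∫ t', imhAcceptQ w q t t' * q t' * g t' ∂μ) * c * w t
      = ∫ t', imhFlow w q t t' * g t' * c ∂μ := by
    rw [← integral_mul_const, ← integral_mul_const]
    refine integral_congr_ae (Eventually.of_forall fun t' => ?_)
    show imhAcceptQ w q t t' * q t' * g t' * c * w t = imhFlow w q t t' * g t' * c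
    rw [← imh_accept_mul_weight w q (hw0 t) (hq0 t')]
    unfold imhAcceptQ
    ring
  rw [← e2]
  ring

/-- **(lin) on `L¹(w)`**: `K(f + c h) = K f + c K h` pointwise. -/
theorem imhOp_add_mul_of_mul_weight (hw0 : ∀ t, 0 < w t) (hwm : Measurable w)
    (hq0 : ∀ t, 0 < q t) (hqm : Measurable q) (hqi : Integrable q μ) {f h : X → ℝ}
    (hfm : Measurable f) (hhm : Measurable h) (hfw : Integrable (fun t => f t * w t) μ)
    (hhw : Integrable (fun t => h t * w t) μ) (c : ℝ) (t : X) :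
    imhOp μ w q (fun s => f s + c * h s) t = imhOp μ w q f t + c * imhOp μ w q h t := by
  unfold imhOp
  have i1 := integrable_imhOp_integrand_of_mul_weight hw0 hwm hq0 hqm hqi hfm hfw t
  have i2 := integrable_imhOp_integrand_of_mul_weight hw0 hwm hq0 hqm hqi hhm hhw t
  have e : ∀ t', (imhAcceptQ w q t t' * (f t' + c * h t')
        + (1 - imhAcceptQ w q t t') * (f t + c * h t)) * q t'
      = (imhAcceptQ w q t t' * f t' + (1 - imhAcceptQ w q t t') * f t) * q t'
        + c * ((imhAcceptQ w q t t' * h t' + (1 - imhAcceptQ w q t t') * h t) * q t') := fun t' => by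
    ring
  simp_rw [e]
  rw [integral_add i1 (i2.const_mul c), integral_const_mul]

/-! ## §3 Product integrability of the symmetrised flow against `L¹(w)` and `L²(w)` observables -/

/-- Joint measurability of the symmetrised flow. -/
theorem measurable_imhFlow (hwm : Measurable w) (hqm : Measurable q) :
    Measurable fun p : X × X => imhFlow w q p.1 p.2 := by
  unfold imhFlow
  exact ((hwm.comp measurable_fst).mul (hqm.comp measurable_snd)).min
    ((hwm.comp measurable_snd).mul (hqm.comp measurable_fst))

/-- `s(t,t') g(t') ∈ L¹(μ ⊗ μ)` for `g ∈ L¹(w)` (dominated by `q(t) · |g w|(t')`). -/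
theorem integrable_imhFlow_mul_snd (hw0 : ∀ t, 0 < w t) (hwm : Measurable w)
    (hq0 : ∀ t, 0 < q t) (hqm : Measurable q) (hqi : Integrable q μ) {g : X → ℝ}
    (hgm : Measurable g) (hgw : Integrable (fun t => g t * w t) μ) :
    Integrable (fun p : X × X => imhFlow w q p.1 p.2 * g p.2) (μ.prod μ) := by
  refine Integrable.mono' (hqi.mul_prod hgw.abs)
    ((measurable_imhFlow hwm hqm).mul (hgm.comp measurable_snd)).aestronglyMeasurable
    (Eventually.of_forall fun p => ?_)
  show ‖imhFlow w q p.1 p.2 * g p.2‖ ≤ q p.1 * |g p.2 * w p.2|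
  have hs0 := (imhFlow_nonneg_le hw0 hq0 p.1 p.2).1
  have hs2 : imhFlow w q p.1 p.2 ≤ w p.2 * q p.1 := by
    rw [imhFlow_symm]; exact (imhFlow_nonneg_le hw0 hq0 p.2 p.1).2
  rw [Real.norm_eq_abs, abs_mul, abs_of_nonneg hs0, abs_mul, abs_of_pos (hw0 p.2)]
  calc imhFlow w q p.1 p.2 * |g p.2| ≤ w p.2 * q p.1 * |g p.2| :=
        mul_le_mul_of_nonneg_right hs2 (abs_nonneg _)
    _ = q p.1 * (|g p.2| * w p.2) := by ring

/-- `s(t,t') g(t) ∈ L¹(μ ⊗ μ)` for `g ∈ L¹(w)` (dominated by `|g w|(t) · q(t')`). -/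
theorem integrable_imhFlow_mul_fst (hw0 : ∀ t, 0 < w t) (hwm : Measurable w)
    (hq0 : ∀ t, 0 < q t) (hqm : Measurable q) (hqi : Integrable q μ) {g : X → ℝ}
    (hgm : Measurable g) (hgw : Integrable (fun t => g t * w t) μ) :
    Integrable (fun p : X × X => imhFlow w q p.1 p.2 * g p.1) (μ.prod μ) := by
  refine Integrable.mono' (hgw.abs.mul_prod hqi)
    ((measurable_imhFlow hwm hqm).mul (hgm.comp measurable_fst)).aestronglyMeasurable
    (Eventually.of_forall fun p => ?_)
  show ‖imhFlow w q p.1 p.2 * g p.1‖ ≤ |g p.1 * w p.1| * q p.2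
  obtain ⟨hs0, hs1⟩ := imhFlow_nonneg_le hw0 hq0 p.1 p.2
  rw [Real.norm_eq_abs, abs_mul, abs_of_nonneg hs0, abs_mul, abs_of_pos (hw0 p.1)]
  calc imhFlow w q p.1 p.2 * |g p.1| ≤ w p.1 * q p.2 * |g p.1| :=
        mul_le_mul_of_nonneg_right hs1 (abs_nonneg _)
    _ = |g p.1| * w p.1 * q p.2 := by ring

omit [MeasurableSpace X] in
/-- The pointwise domination behind every `L²` Fubini step:
`s(t,t') |f(t')| |h(t)| ≤ h(t)² w(t) q(t') + q(t) f(t')² w(t')` (`2|f' h| ≤ f'² + h²`, then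
`s ≤ w q'` on the `h²` term and `s ≤ w' q` on the `f'²` term). -/
theorem imhFlow_mul_abs_mul_abs_le (hw0 : ∀ t, 0 < w t) (hq0 : ∀ t, 0 < q t) (f h : X → ℝ)
    (t t' : X) :
    imhFlow w q t t' * |f t'| * |h t| ≤ h t ^ 2 * w t * q t' + q t * (f t' ^ 2 * w t') := by
  obtain ⟨hs0, hs1⟩ := imhFlow_nonneg_le hw0 hq0 t t'
  have hs2 : imhFlow w q t t' ≤ w t' * q t := by
    rw [imhFlow_symm]; exact (imhFlow_nonneg_le hw0 hq0 t' t).2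
  have hfh : |f t'| * |h t| ≤ f t' ^ 2 + h t ^ 2 := abs_mul_abs_le_sq_add_sq _ _
  calc imhFlow w q t t' * |f t'| * |h t| = imhFlow w q t t' * (|f t'| * |h t|) := by ring
    _ ≤ imhFlow w q t t' * (f t' ^ 2 + h t ^ 2) := mul_le_mul_of_nonneg_left hfh hs0
    _ = imhFlow w q t t' * f t' ^ 2 + imhFlow w q t t' * h t ^ 2 := by ring
    _ ≤ w t' * q t * f t' ^ 2 + w t * q t' * h t ^ 2 :=
        add_le_add (mul_le_mul_of_nonneg_right hs2 (sq_nonneg _))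
          (mul_le_mul_of_nonneg_right hs1 (sq_nonneg _))
    _ = h t ^ 2 * w t * q t' + q t * (f t' ^ 2 * w t') := by ring

/-- **`s(t,t') f(t') h(t) ∈ L¹(μ ⊗ μ)` for square-integrable `f, h`** — no moment hypothesis on the
model density. -/
theorem integrable_imhFlow_mul_mul_of_sq (hw0 : ∀ t, 0 < w t) (hwm : Measurable w)
    (hq0 : ∀ t, 0 < q t) (hqm : Measurable q) (hqi : Integrable q μ) {f h : X → ℝ}
    (hfm : Measurable f) (hhm : Measurable h) (hf2 : Integrable (fun t => f t ^ 2 * w t) μ)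
    (hh2 : Integrable (fun t => h t ^ 2 * w t) μ) :
    Integrable (fun p : X × X => imhFlow w q p.1 p.2 * f p.2 * h p.1) (μ.prod μ) := by
  have hD : Integrable (fun p : X × X => h p.1 ^ 2 * w p.1 * q p.2 + q p.1 * (f p.2 ^ 2 * w p.2))
      (μ.prod μ) := (hh2.mul_prod hqi).add (hqi.mul_prod hf2)
  refine Integrable.mono' hD
    (((measurable_imhFlow hwm hqm).mul (hfm.comp measurable_snd)).mul
      (hhm.comp measurable_fst)).aestronglyMeasurable
    (Eventually.of_forall fun p => ?_)
  rw [Real.norm_eq_abs, abs_mul, abs_mul, abs_of_nonneg (imhFlow_nonneg_le hw0 hq0 p.1 p.2).1]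
  exact imhFlow_mul_abs_mul_abs_le hw0 hq0 f h p.1 p.2

/-! ## §4 Exactness on `L¹(w)` and detailed balance on `L²(w)` -/

variable [SFinite μ]

/-- **EXACTNESS ON `L¹(w)`**: for every measurable `g` with `g w ∈ L¹` (in particular every
square-integrable `g`, and `g = f²` for square-integrable `f`), `(K g) w ∈ L¹` and
`∫ (K g) w dμ = ∫ g w dμ` — however badly the flow is trained. -/
theorem integral_imhOp_mul_weight (hw0 : ∀ t, 0 < w t) (hwm : Measurable w)
    (hq0 : ∀ t, 0 < q t) (hqm : Measurable q) (hqi : Integrable q μ) (hq1 : ∫ t, q t ∂μ = 1)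
    {g : X → ℝ} (hgm : Measurable g) (hgw : Integrable (fun t => g t * w t) μ) :
    Integrable (fun t => imhOp μ w q g t * w t) μ ∧
      ∫ t, imhOp μ w q g t * w t ∂μ = ∫ t, g t * w t ∂μ := by
  obtain ⟨hr0, hr1, hrm⟩ := rejection_bounds (μ := μ) hw0 hwm hq0 hqm hqi hq1
  -- pointwise split with `c = 1`
  have hpt : ∀ t, imhOp μ w q g t * w t
      = (∫ t', imhFlow w q t t' * g t' ∂μ) + g t * w t * ∫ t', (1 - imhAcceptQ w q t t') * q t' ∂μ := by
    intro t
    have h := imhOp_mul_mul_weight_eq hw0 hwm hq0 hqm hqi hgm hgw t 1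
    simp only [mul_one] at h
    exact h
  have hI1 : Integrable (fun t => ∫ t', imhFlow w q t t' * g t' ∂μ) μ :=
    (integrable_imhFlow_mul_snd hw0 hwm hq0 hqm hqi hgm hgw).integral_prod_left
  have hI2 : Integrable (fun t => g t * w t * ∫ t', (1 - imhAcceptQ w q t t') * q t' ∂μ) μ := by
    refine Integrable.mono' hgw.abs ((hgm.mul hwm).mul hrm).aestronglyMeasurable
      (Eventually.of_forall fun t => ?_)
    rw [Real.norm_eq_abs, abs_mul, abs_of_nonneg (hr0 t)]
    exact mul_le_of_le_one_right (abs_nonneg _) (hr1 t)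
  refine ⟨(hI1.add hI2).congr (Eventually.of_forall fun t => (hpt t).symm), ?_⟩
  -- the rejection term: `g w r = g w − ∫ s(t,·) g(t)`
  have hrej : ∀ t, g t * w t * ∫ t', (1 - imhAcceptQ w q t t') * q t' ∂μ
      = g t * w t - ∫ t', imhFlow w q t t' * g t ∂μ := by
    intro t
    have e : ∀ t', (1 - imhAcceptQ w q t t') * q t' = q t' - imhAcceptQ w q t t' * q t' :=
      fun t' => by ring
    simp_rw [e]
    rw [integral_sub hqi (integrable_imhAcceptQ_mul hw0 hwm hq0 hqm hqi t), hq1]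
    have hdiag : ∫ t', imhFlow w q t t' * g t ∂μ
        = (∫ t', imhAcceptQ w q t t' * q t' ∂μ) * (g t * w t) := by
      rw [← integral_mul_const]
      refine integral_congr_ae (Eventually.of_forall fun t' => ?_)
      show imhFlow w q t t' * g t = imhAcceptQ w q t t' * q t' * (g t * w t)
      rw [← imh_accept_mul_weight w q (hw0 t) (hq0 t')]
      unfold imhAcceptQ
      ring
    rw [hdiag]
    ring
  have hI3 : Integrable (fun t => ∫ t', imhFlow w q t t' * g t ∂μ) μ :=
    (integrable_imhFlow_mul_fst hw0 hwm hq0 hqm hqi hgm hgw).integral_prod_left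
  -- the two double integrals agree (swap + symmetry of `s`)
  have hswap : ∫ t, ∫ t', imhFlow w q t t' * g t' ∂μ ∂μ = ∫ t, ∫ t', imhFlow w q t t' * g t ∂μ ∂μ := by
    rw [integral_integral_swap (integrable_imhFlow_mul_snd hw0 hwm hq0 hqm hqi hgm hgw)]
    refine integral_congr_ae (Eventually.of_forall fun a => ?_)
    refine integral_congr_ae (Eventually.of_forall fun b => ?_)
    show imhFlow w q b a * g a = imhFlow w q a b * g a
    rw [imhFlow_symm]
  rw [integral_congr_ae (Eventually.of_forall hpt), integral_add hI1 hI2]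
  simp_rw [hrej]
  rw [integral_sub hgw hI3, hswap]
  ring

end General

end Summit.Ventures.LatticeQCDFlow.Exactness
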